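import Literature.MathematicalPhysics.QuantumFieldTheory.BalabanImbrieJaffe1984to88.BIJ88Ineq576Proof

/-!
# `BalabanImbrieJaffe1984to88.BIJ88Ineq555Proof` — T. Bałaban, J. Imbrie, A. Jaffe, *Effective action and cluster
properties of the abelian Higgs model*, Commun. Math. Phys. **114** (1988) 257–315 [BalabanImbrieJaffe1988]:
**(5.5.5)** p. 284 PROVED — *"The ½r(e_k)-cube □ is centered near the plaquette that we are evaluating σ_{k,loc}∂Λ₂^{(k)*}A^{(k)}
at. The kernels w′₃, w″₃ have range less than ½r(e_k), and we have |w′₃(p,b)|, |w″₃(p,b)| ≤ e^{−cr(e_k)}. (5.5.5) In (5.5.4) we have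
applied our usual method for obtaining formulas for localized kernels analogous to those valid for unlocalized ones [in this
case, (5.5.1)]."* — for the CONCRETE kernels `w′₃ = (σ_{k,loc} − σ_k)∂Λ₂^{(k)*}□` and `w″₃ = w′₃ + Q^e_k∂^η(H_kΛ₂^{(k)*}□ − H_{k,loc}Λ₂^{(k)*})`
of (5.5.4) = `BIJ88Sect5StatementsPart3.wPrime3` / `wDoublePrime3` (r16, p243601) in the ring `Matrix ι ι ℝ` of kernels over a
finite index type (kind «model-instance»: the typed leaf `BIJ88Sect5StatementsPart2.Ineq555` quantifies over abstract kernels).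

statement-level skeleton of published theorems with citation tags; proofs where landed; nothing here is a claim about the Yang–Mills mass gap

PDF held: `paper:balaban1988-cmp114-bij-abelian-higgs-effective-action` (journal page = PDF page + 256).  Pages read as
images: PDF pp. 27–28 (journal 283–284), `g4png.py` ×2 renders (seat folder `renders/original-p027-x2.png`, `-p028-x2.png`).

CITATION HEADER (lean-in-tree rule).  Part of the lit-balaban TYPED SKELETON (HOME `run/shared/lean/pub/lit-balaban/`),
Phase 2, seat p36 (gen 3, unit `lit-balaban-p36`); row **C2.Eq5.5.5** of `HOME/lit-balaban-r16/ROWS-C2-part2.md` (leaf typed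
p240155, kernels typed p243601, both r16).  WHAT IS REPRODUCED, and how — *"our usual method for … localized kernels"* as
finite kernel algebra, every constant explicit, theorem-only file:
* THE CUBE `□ = □(p)` DEPENDS ON THE EVALUATION PLAQUETTE (verbatim above); the ring element `box` of `wPrime3`/`wDoublePrime3`
  is therefore instantiated ROW BY ROW: `w′₃(p,b) := (wPrime3 σloc σ ∂ (diagonal χ₂) (diagonal (χ□ p))) p b`, with `Λ₂^{(k)*}` and
  `□(p)` the diagonal 0/1 (more generally: contraction) matrices `diagonal χ₂`, `diagonal (χ□ p)`, and the geometric clause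
  *"centered near the plaquette"* typed as: `□(p)` contains every `b` with `dist(p,b) ≤ r(e_k)/8 + ρ_Q + ρ_∂` (`ρ_Q`, `ρ_∂` the
  ranges of the local operators `Q^e_k`, `∂^η`; a ½r(e_k)-cube centered within `O(1)` of `p` does, for `r(e_k)` large).
* §1 `w′₃`: `|w′₃(p,b)| ≤ K_∂·δ_σ·S` from **(2.18)** `BIJ88Sect2Statements.Close dist σloc σ δ_σ c_σ` (`|σ_{k,loc} − σ_k| ≤ δ_σe^{−c_σdist}`),
  `|∂(p′,b)| ≤ K_∂`, `|χ₂|, |χ□| ≤ 1`, and the lattice sum `Σ_{p′} e^{−c_σ dist(p,p′)} ≤ S` (`abs_wPrime3_le`).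
* §2 the correction `w″₃ − w′₃ = Q^e_k∂^η(H_kΛ₂□ − H_{k,loc}Λ₂)`: `≤ K_Q·K_∂η·δ_H` from **(2.7)** `Close dist Hloc Hk δ_H c_H`, **(2.6)**
  `Vanishes dist Hloc (r/8)`, the row sums / ranges of `Q^e_k`, `∂^η`, and the containment clause of `□(p)` (`abs_corr3_le`): at a
  bond `b ∈ □(p)` the bracket is `H_k − H_{k,loc}`; at `b ∉ □(p)` it is `H_k(b″,b)` with `dist(b″,b) > r/8`, where `H_{k,loc} = 0`, so
  again `= H_k − H_{k,loc}` — the mechanism of the *"usual method"*.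
* §3 **(5.5.5)**: with `δ_σ = C_σe^{−c₁r}`, `δ_H = C_He^{−c₁r}` and `r = r(e_k)` LARGE (`C_σK_∂S + C_HK_QK_∂η ≤ e^{c₁r/2}`):
  `ineq555_matrix : Ineq555 ι ι w′₃ w″₃ (c₁/2) r`; and on `ℤ^d` (sup-norm, `≤ N` indices per site) with the lattice sum DISCHARGED by
  `BIJ88Ineq576Proof.sum_exp_neg_supDist_fiber_le` (`S = N(1 + 2d/c_σ)^d`): `ineq555_Zd`.
NOT here: the range clause *"range less than ½r(e_k)"* (a property of the carrier, not part of the typed leaf — though `w′₃(p,b) = 0`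
off `□(p)` is immediate from the factor `χ□(p)(b)`, `wPrime3_eq_zero_of`), the identification of `σ_k, σ_{k,loc}, H_k, H_{k,loc}, Q^e_k,
∂^η` with the operators of [2] (they enter through the displayed hypotheses (2.6), (2.7), (2.18), exactly as in print); no new `Prop`
facts; axioms standard.
-/

namespace Literature.MathematicalPhysics.QuantumFieldTheory.BalabanImbrieJaffe1984to88.BIJ88Ineq555Proof

open Finset Matrix
open BIJ88Sect2Statements (Close Vanishes)
open BIJ88Sect5StatementsPart2 BIJ88Sect5StatementsPart3 BIJ88WalkGeometryZd BIJ88Ineq576Proof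

/-! ## §1 The kernel `w′₃ = (σ_{k,loc} − σ_k)∂Λ₂□` -/

section Kernel

variable {ι : Type*} [Fintype ι] [DecidableEq ι]

/-- entries of `w′₃` for diagonal `Λ₂ = diagonal χ₂` and `□ = diagonal χ□`:
`w′₃(p,b) = (Σ_{p′}(σ_loc − σ)(p,p′)∂(p′,b))·χ₂(b)·χ□(b)`. [cite: BalabanImbrieJaffe1988, (5.5.4) p.284] -/
theorem wPrime3_apply (σloc σ d1 : Matrix ι ι ℝ) (χ₂ χb : ι → ℝ) (p b : ι) :
    wPrime3 σloc σ d1 (diagonal χ₂) (diagonal χb) p b = (∑ p', (σloc p p' - σ p p') * d1 p' b) * χ₂ b * χb b := by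
  unfold wPrime3
  rw [Matrix.mul_diagonal, Matrix.mul_diagonal, Matrix.mul_apply]
  rfl

/-- the range clause mechanism: `w′₃(p,b) = 0` wherever `χ□(b) = 0` (off the cube `□`). [cite: BalabanImbrieJaffe1988, (5.5.5) p.284] -/
theorem wPrime3_eq_zero_of (σloc σ d1 : Matrix ι ι ℝ) (χ₂ χb : ι → ℝ) {p b : ι} (hb : χb b = 0) :
    wPrime3 σloc σ d1 (diagonal χ₂) (diagonal χb) p b = 0 := by
  rw [wPrime3_apply, hb, mul_zero]

/-- **`|w′₃(p,b)| ≤ K_∂·δ_σ·S`** from (2.18) `|σ_{k,loc} − σ_k|(p,p′) ≤ δ_σe^{−c_σ dist(p,p′)}`, `|∂(p′,b)| ≤ K_∂`, `|χ₂|, |χ□| ≤ 1`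
and the lattice sum `Σ_{p′} e^{−c_σ dist(p,p′)} ≤ S`. [cite: BalabanImbrieJaffe1988, (5.5.5) p.284] -/
theorem abs_wPrime3_le (dist : ι → ι → ℝ) {σloc σ d1 : Matrix ι ι ℝ} {χ₂ χb : ι → ℝ} {δσ cσ Kd S : ℝ}
    (hσ : Close dist σloc σ δσ cσ) (hδσ : 0 ≤ δσ) (hd1 : ∀ p' b, |d1 p' b| ≤ Kd)
    (hχ₂ : ∀ b, |χ₂ b| ≤ 1) (hχb : ∀ b, |χb b| ≤ 1) (p : ι) (hS : ∑ p', Real.exp (-cσ * dist p p') ≤ S) (b : ι) :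
    |wPrime3 σloc σ d1 (diagonal χ₂) (diagonal χb) p b| ≤ Kd * δσ * S := by
  rw [wPrime3_apply]
  have hKd : 0 ≤ Kd := (abs_nonneg _).trans (hd1 p b)
  have hsum : |∑ p', (σloc p p' - σ p p') * d1 p' b| ≤ Kd * δσ * S := by
    calc |∑ p', (σloc p p' - σ p p') * d1 p' b| ≤ ∑ p', |(σloc p p' - σ p p') * d1 p' b| :=
          Finset.abs_sum_le_sum_abs _ _
      _ ≤ ∑ p', δσ * Real.exp (-cσ * dist p p') * Kd := by
          refine Finset.sum_le_sum fun p' _ => ?_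
          rw [abs_mul]
          exact mul_le_mul (hσ p p') (hd1 p' b) (abs_nonneg _) (by positivity)
      _ = Kd * δσ * ∑ p', Real.exp (-cσ * dist p p') := by rw [Finset.mul_sum]; exact Finset.sum_congr rfl fun _ _ => by ring
      _ ≤ Kd * δσ * S := mul_le_mul_of_nonneg_left hS (by positivity)
  have h1 : |(∑ p', (σloc p p' - σ p p') * d1 p' b) * χ₂ b * χb b| ≤ |∑ p', (σloc p p' - σ p p') * d1 p' b| := by
    rw [abs_mul, abs_mul]
    calc |∑ p', (σloc p p' - σ p p') * d1 p' b| * |χ₂ b| * |χb b|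
        ≤ |∑ p', (σloc p p' - σ p p') * d1 p' b| * 1 * 1 := by
          gcongr
          · exact hχ₂ b
          · exact hχb b
      _ = _ := by ring
  exact h1.trans hsum

/-! ## §2 The correction `w″₃ − w′₃ = Q^e_k∂^η(H_kΛ₂□ − H_{k,loc}Λ₂)` -/

/-- entries of `w″₃`: `w″₃(p,b) = w′₃(p,b) + Σ_{b″}Σ_{p″} Q^e(p,p″)∂^η(p″,b″)·χ₂(b)·(H_k(b″,b)χ□(b) − H_loc(b″,b))`.
[cite: BalabanImbrieJaffe1988, (5.5.4) p.284] -/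
theorem wDoublePrime3_apply (σloc σ d1 Qe dη Hk Hloc : Matrix ι ι ℝ) (χ₂ χb : ι → ℝ) (p b : ι) :
    wDoublePrime3 σloc σ d1 (diagonal χ₂) (diagonal χb) Qe dη Hk Hloc p b =
      wPrime3 σloc σ d1 (diagonal χ₂) (diagonal χb) p b +
        ∑ b'', ∑ p'', Qe p p'' * dη p'' b'' * (χ₂ b * (Hk b'' b * χb b - Hloc b'' b)) := by
  unfold wDoublePrime3
  rw [Matrix.add_apply, Matrix.mul_apply]
  congr 1
  refine Finset.sum_congr rfl fun b'' _ => ?_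
  rw [Matrix.mul_apply, Finset.sum_mul, Matrix.sub_apply, Matrix.mul_diagonal, Matrix.mul_diagonal, Matrix.mul_diagonal]
  exact Finset.sum_congr rfl fun p'' _ => by ring

omit [Fintype ι] [DecidableEq ι] in
/-- **THE "USUAL METHOD"**, one bracket: if `b ∈ □(p)` (`χ□(b) = 1`) the bracket `H_k(b″,b)χ□(b) − H_loc(b″,b)` is `H_k − H_loc`; if
`b ∉ □(p)` then, `□(p)` containing the `(r/8 + ρ)`-ball of `p` and `b″` being within `ρ` of `p`, `dist(b″,b) > r/8` and `H_loc(b″,b) = 0`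
by (2.6), so the bracket is `H_k(b″,b)χ□(b)` with `|H_k(b″,b)| = |H_k − H_loc|(b″,b)`; either way `≤ δ_H` by (2.7).
[cite: BalabanImbrieJaffe1988, (5.5.5) p.284] -/
theorem abs_bracket_le (dist : ι → ι → ℝ) (hdist : ∀ i j, 0 ≤ dist i j) (htri : ∀ i j l, dist i l ≤ dist i j + dist j l)
    {Hk Hloc : Matrix ι ι ℝ} {χb : ι → ℝ} {δH cH r ρ : ℝ} (hH : Close dist Hloc Hk δH cH) (hcH : 0 ≤ cH)
    (h26 : Vanishes dist Hloc (r / 8)) (hχb : ∀ b, |χb b| ≤ 1) {p : ι}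
    (hbox : ∀ b, dist p b ≤ r / 8 + ρ → χb b = 1) {b'' : ι} (hb'' : dist p b'' ≤ ρ) (b : ι) :
    |Hk b'' b * χb b - Hloc b'' b| ≤ δH := by
  have hclose : |Hloc b'' b - Hk b'' b| ≤ δH := by
    refine (hH b'' b).trans ?_
    have hδH : 0 ≤ δH := by
      have h := (abs_nonneg _).trans (hH b'' b)
      have he : 0 < Real.exp (-cH * dist b'' b) := Real.exp_pos _
      nlinarith
    have : Real.exp (-cH * dist b'' b) ≤ 1 := by
      rw [Real.exp_le_one_iff]
      nlinarith [hdist b'' b]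
    nlinarith
  by_cases hb : χb b = 1
  · rw [hb, mul_one, abs_sub_comm]
    exact hclose
  · have hfar : r / 8 + ρ < dist p b := by
      by_contra h
      exact hb (hbox b (not_lt.mp h))
    have hfar' : r / 8 ≤ dist b'' b := by linarith [htri p b'' b]
    have h0 : Hloc b'' b = 0 := h26 b'' b hfar'
    rw [h0, sub_zero, abs_mul]
    rw [h0, zero_sub, abs_neg] at hclose
    calc |Hk b'' b| * |χb b| ≤ |Hk b'' b| * 1 := mul_le_mul_of_nonneg_left (hχb b) (abs_nonneg _)
      _ ≤ δH := by rw [mul_one]; exact hclose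

omit [DecidableEq ι] in
/-- **`|(w″₃ − w′₃)(p,b)| ≤ K_Q·K_∂η·δ_H`**: the correction term summed against the local operators `Q^e_k` (row sums `≤ K_Q`, range
`ρ_Q`) and `∂^η` (row sums `≤ K_∂η`, range `ρ_∂`), `|χ₂| ≤ 1`, with `□(p) ⊇ {b : dist(p,b) ≤ r/8 + ρ_Q + ρ_∂}`.
[cite: BalabanImbrieJaffe1988, (5.5.5) p.284] -/
theorem abs_corr3_le (dist : ι → ι → ℝ) (hdist : ∀ i j, 0 ≤ dist i j) (htri : ∀ i j l, dist i l ≤ dist i j + dist j l)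
    {Qe dη Hk Hloc : Matrix ι ι ℝ} {χ₂ χb : ι → ℝ} {δH cH Kq Kη ρq ρη r : ℝ} (hH : Close dist Hloc Hk δH cH) (hcH : 0 ≤ cH)
    (h26 : Vanishes dist Hloc (r / 8)) {p : ι} (hQe : ∑ p'', |Qe p p''| ≤ Kq) (hQloc : ∀ p'', Qe p p'' ≠ 0 → dist p p'' ≤ ρq)
    (hdη : ∀ p'', ∑ b'', |dη p'' b''| ≤ Kη) (hdηloc : ∀ p'' b'', dη p'' b'' ≠ 0 → dist p'' b'' ≤ ρη)
    (hχ₂ : ∀ b, |χ₂ b| ≤ 1) (hχb : ∀ b, |χb b| ≤ 1) (hbox : ∀ b, dist p b ≤ r / 8 + (ρq + ρη) → χb b = 1) (b : ι) :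
    |∑ b'', ∑ p'', Qe p p'' * dη p'' b'' * (χ₂ b * (Hk b'' b * χb b - Hloc b'' b))| ≤ Kq * Kη * δH := by
  have hKη : 0 ≤ Kη := (Finset.sum_nonneg fun _ _ => abs_nonneg _).trans (hdη p)
  have hδH : 0 ≤ δH := by
    have h := (abs_nonneg _).trans (hH b b)
    have he : 0 < Real.exp (-cH * dist b b) := Real.exp_pos _
    nlinarith
  -- termwise: |Q(p,p″)∂(p″,b″)·χ₂(b)·bracket| ≤ |Q(p,p″)||∂(p″,b″)|·δ_H
  have hterm : ∀ b'' p'', |Qe p p'' * dη p'' b'' * (χ₂ b * (Hk b'' b * χb b - Hloc b'' b))|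
      ≤ |Qe p p''| * |dη p'' b''| * δH := by
    intro b'' p''
    rw [abs_mul, abs_mul, abs_mul]
    by_cases hQ : Qe p p'' = 0
    · simp [hQ]
    by_cases hd : dη p'' b'' = 0
    · simp [hd]
    have hb'' : dist p b'' ≤ ρq + ρη := (htri p p'' b'').trans (add_le_add (hQloc p'' hQ) (hdηloc p'' b'' hd))
    have hbr := abs_bracket_le dist hdist htri hH hcH h26 hχb (ρ := ρq + ρη) hbox hb'' b
    have h2 : |χ₂ b| * |Hk b'' b * χb b - Hloc b'' b| ≤ 1 * δH :=
      mul_le_mul (hχ₂ b) hbr (abs_nonneg _) zero_le_one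
    rw [one_mul] at h2
    exact mul_le_mul_of_nonneg_left h2 (by positivity)
  calc |∑ b'', ∑ p'', Qe p p'' * dη p'' b'' * (χ₂ b * (Hk b'' b * χb b - Hloc b'' b))|
      ≤ ∑ b'', |∑ p'', Qe p p'' * dη p'' b'' * (χ₂ b * (Hk b'' b * χb b - Hloc b'' b))| := Finset.abs_sum_le_sum_abs _ _
    _ ≤ ∑ b'', ∑ p'', |Qe p p''| * |dη p'' b''| * δH :=
        Finset.sum_le_sum fun b'' _ => (Finset.abs_sum_le_sum_abs _ _).trans (Finset.sum_le_sum fun p'' _ => hterm b'' p'')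
    _ = δH * ∑ p'', |Qe p p''| * ∑ b'', |dη p'' b''| := by
        rw [Finset.sum_comm, Finset.mul_sum]
        refine Finset.sum_congr rfl fun p'' _ => ?_
        rw [Finset.mul_sum, Finset.mul_sum]
        exact Finset.sum_congr rfl fun b'' _ => by ring
    _ ≤ δH * ∑ p'', |Qe p p''| * Kη := by
        refine mul_le_mul_of_nonneg_left (Finset.sum_le_sum fun p'' _ => ?_) hδH
        exact mul_le_mul_of_nonneg_left (hdη p'') (abs_nonneg _)
    _ = δH * Kη * ∑ p'', |Qe p p''| := by rw [← Finset.sum_mul]; ring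
    _ ≤ δH * Kη * Kq := mul_le_mul_of_nonneg_left hQe (by positivity)
    _ = Kq * Kη * δH := by ring

end Kernel

/-! ## §3 (5.5.5) -/

section Main

variable {ι : Type} [Fintype ι] [DecidableEq ι]

/-- **(5.5.5) in the ring of kernels** `Matrix ι ι ℝ` (any finite index type with a distance satisfying the triangle inequality),
`□ = □(p)` row by row: from (2.18) `|σ_{k,loc} − σ_k| ≤ C_σe^{−c₁r}e^{−c_σdist}`, (2.7) `|H_{k,loc} − H_k| ≤ C_He^{−c₁r}e^{−c_Hdist}`,
(2.6) `H_{k,loc} = 0` beyond `r/8`, `|∂| ≤ K_∂`, the local operators `Q^e_k`, `∂^η` (row sums `≤ K_Q, K_∂η`, ranges `ρ_Q, ρ_∂`), `Λ₂`,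
`□(p)` diagonal contractions with `□(p) ⊇ {b : dist(p,b) ≤ r/8 + ρ_Q + ρ_∂}`, the lattice sum `Σ_{p′}e^{−c_σdist(p,p′)} ≤ S`, and
`r = r(e_k)` LARGE: `C_σK_∂S + C_HK_QK_∂η ≤ e^{c₁r/2}`.  Then `|w′₃(p,b)|, |w″₃(p,b)| ≤ e^{−(c₁/2)r}` for all `p, b`.
[cite: BalabanImbrieJaffe1988, (5.5.5) p.284] -/
theorem ineq555_matrix (dist : ι → ι → ℝ) (hdist : ∀ i j, 0 ≤ dist i j) (htri : ∀ i j l, dist i l ≤ dist i j + dist j l)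
    (σloc σ d1 Qe dη Hk Hloc : Matrix ι ι ℝ) (χ₂ : ι → ℝ) (χb : ι → ι → ℝ)
    {r c₁ Cσ cσ CH cH Kd Kq Kη ρq ρη S : ℝ} (hCσ : 0 ≤ Cσ) (hCH : 0 ≤ CH) (hcH : 0 ≤ cH)
    (h218 : Close dist σloc σ (Cσ * Real.exp (-(c₁ * r))) cσ)
    (h27 : Close dist Hloc Hk (CH * Real.exp (-(c₁ * r))) cH) (h26 : Vanishes dist Hloc (r / 8))
    (hd1 : ∀ p' b, |d1 p' b| ≤ Kd) (hQe : ∀ p, ∑ p'', |Qe p p''| ≤ Kq) (hQloc : ∀ p p'', Qe p p'' ≠ 0 → dist p p'' ≤ ρq)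
    (hdη : ∀ p'', ∑ b'', |dη p'' b''| ≤ Kη) (hdηloc : ∀ p'' b'', dη p'' b'' ≠ 0 → dist p'' b'' ≤ ρη)
    (hχ₂ : ∀ b, |χ₂ b| ≤ 1) (hχb : ∀ p b, |χb p b| ≤ 1) (hbox : ∀ p b, dist p b ≤ r / 8 + (ρq + ρη) → χb p b = 1)
    (hS : ∀ p, ∑ p', Real.exp (-cσ * dist p p') ≤ S) (hlarge : Cσ * Kd * S + CH * Kq * Kη ≤ Real.exp (c₁ * r / 2)) :
    Ineq555 ι ι (fun p b => wPrime3 σloc σ d1 (diagonal χ₂) (diagonal (χb p)) p b)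
      (fun p b => wDoublePrime3 σloc σ d1 (diagonal χ₂) (diagonal (χb p)) Qe dη Hk Hloc p b) (c₁ / 2) r := by
  intro p b
  have hKd : 0 ≤ Kd := (abs_nonneg _).trans (hd1 p b)
  have hKq : 0 ≤ Kq := (Finset.sum_nonneg fun _ _ => abs_nonneg _).trans (hQe p)
  have hKη : 0 ≤ Kη := (Finset.sum_nonneg fun _ _ => abs_nonneg _).trans (hdη p)
  have hS0 : 0 ≤ S := (Finset.sum_nonneg fun _ _ => (Real.exp_pos _).le).trans (hS p)
  have h1 : |wPrime3 σloc σ d1 (diagonal χ₂) (diagonal (χb p)) p b| ≤ Kd * (Cσ * Real.exp (-(c₁ * r))) * S :=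
    abs_wPrime3_le dist h218 (by positivity) hd1 hχ₂ (hχb p) p (hS p) b
  have h2 : |∑ b'', ∑ p'', Qe p p'' * dη p'' b'' * (χ₂ b * (Hk b'' b * χb p b - Hloc b'' b))|
      ≤ Kq * Kη * (CH * Real.exp (-(c₁ * r))) :=
    abs_corr3_le dist hdist htri h27 hcH h26 (hQe p) (hQloc p) hdη hdηloc hχ₂ (hχb p) (hbox p) b
  -- the arithmetic of "r(e_k) large": (C_σK_∂S + C_HK_QK_∂η)e^{−c₁r} ≤ e^{−(c₁/2)r}
  have hexp : (Cσ * Kd * S + CH * Kq * Kη) * Real.exp (-(c₁ * r)) ≤ Real.exp (-(c₁ / 2 * r)) := by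
    calc (Cσ * Kd * S + CH * Kq * Kη) * Real.exp (-(c₁ * r)) ≤ Real.exp (c₁ * r / 2) * Real.exp (-(c₁ * r)) :=
          mul_le_mul_of_nonneg_right hlarge (Real.exp_pos _).le
      _ = Real.exp (-(c₁ / 2 * r)) := by rw [← Real.exp_add]; congr 1; ring
  have hA : Kd * (Cσ * Real.exp (-(c₁ * r))) * S ≤ Real.exp (-(c₁ / 2 * r)) := by
    have : Kd * (Cσ * Real.exp (-(c₁ * r))) * S ≤ (Cσ * Kd * S + CH * Kq * Kη) * Real.exp (-(c₁ * r)) := by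
      have h0 : 0 ≤ CH * Kq * Kη * Real.exp (-(c₁ * r)) := by positivity
      nlinarith
    exact this.trans hexp
  refine ⟨h1.trans hA, ?_⟩
  show |wDoublePrime3 σloc σ d1 (diagonal χ₂) (diagonal (χb p)) Qe dη Hk Hloc p b| ≤ Real.exp (-(c₁ / 2 * r))
  rw [wDoublePrime3_apply]
  refine (abs_add_le _ _).trans ?_
  refine (add_le_add h1 h2).trans ?_
  have : Kd * (Cσ * Real.exp (-(c₁ * r))) * S + Kq * Kη * (CH * Real.exp (-(c₁ * r)))
      = (Cσ * Kd * S + CH * Kq * Kη) * Real.exp (-(c₁ * r)) := by ring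
  rw [this]
  exact hexp

/-- **(5.5.5) on `ℤ^d`** (indices placed in `ℤ^d` by `pos`, at most `N` per site, sup-norm distances, `d ≥ 1`): as `ineq555_matrix` with the
lattice sum DISCHARGED, `S = N(1 + 2d/c_σ)^d` (`BIJ88Ineq576Proof.sum_exp_neg_supDist_fiber_le`); the largeness of `r(e_k)` reads
`C_σK_∂N(1 + 2d/c_σ)^d + C_HK_QK_∂η ≤ e^{c₁r/2}`. [cite: BalabanImbrieJaffe1988, (5.5.5) p.284] -/
theorem ineq555_Zd {dd : ℕ} (hd : 0 < dd) (pos : ι → Fin dd → ℤ) (N : ℕ)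
    (hN : ∀ y, (Finset.univ.filter fun i => pos i = y).card ≤ N)
    (σloc σ d1 Qe dη Hk Hloc : Matrix ι ι ℝ) (χ₂ : ι → ℝ) (χb : ι → ι → ℝ)
    {r c₁ Cσ cσ CH cH Kd Kq Kη ρq ρη : ℝ} (hCσ : 0 ≤ Cσ) (hcσ : 0 < cσ) (hCH : 0 ≤ CH) (hcH : 0 ≤ cH)
    (h218 : Close (fun i j => supDist (pos i) (pos j)) σloc σ (Cσ * Real.exp (-(c₁ * r))) cσ)
    (h27 : Close (fun i j => supDist (pos i) (pos j)) Hloc Hk (CH * Real.exp (-(c₁ * r))) cH)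
    (h26 : Vanishes (fun i j => supDist (pos i) (pos j)) Hloc (r / 8))
    (hd1 : ∀ p' b, |d1 p' b| ≤ Kd) (hQe : ∀ p, ∑ p'', |Qe p p''| ≤ Kq)
    (hQloc : ∀ p p'', Qe p p'' ≠ 0 → supDist (pos p) (pos p'') ≤ ρq)
    (hdη : ∀ p'', ∑ b'', |dη p'' b''| ≤ Kη) (hdηloc : ∀ p'' b'', dη p'' b'' ≠ 0 → supDist (pos p'') (pos b'') ≤ ρη)
    (hχ₂ : ∀ b, |χ₂ b| ≤ 1) (hχb : ∀ p b, |χb p b| ≤ 1)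
    (hbox : ∀ p b, supDist (pos p) (pos b) ≤ r / 8 + (ρq + ρη) → χb p b = 1)
    (hlarge : Cσ * Kd * (N * (1 + 2 * dd / cσ) ^ dd) + CH * Kq * Kη ≤ Real.exp (c₁ * r / 2)) :
    Ineq555 ι ι (fun p b => wPrime3 σloc σ d1 (diagonal χ₂) (diagonal (χb p)) p b)
      (fun p b => wDoublePrime3 σloc σ d1 (diagonal χ₂) (diagonal (χb p)) Qe dη Hk Hloc p b) (c₁ / 2) r := by
  refine ineq555_matrix (fun i j => supDist (pos i) (pos j)) (fun i j => supDist_nonneg _ _)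
    (fun i j l => supDist_triangle _ _ _) σloc σ d1 Qe dη Hk Hloc χ₂ χb hCσ hCH hcH h218 h27 h26 hd1 hQe hQloc hdη hdηloc
    hχ₂ hχb hbox (S := N * (1 + 2 * dd / cσ) ^ dd) (fun p => ?_) hlarge
  have h := sum_exp_neg_supDist_fiber_le hd pos N hN hcσ p
  refine le_trans (le_of_eq (Finset.sum_congr rfl fun p' _ => ?_)) h
  rw [neg_mul]

end Main

end Literature.MathematicalPhysics.QuantumFieldTheory.BalabanImbrieJaffe1984to88.BIJ88Ineq555Proof
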